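import Summits.Ventures.PercRepro.C026PFunStarPos
import Summits.Ventures.PercRepro.C026PFunSlack

/-!
# The star bracket with virtual components (p6, gen 16; mine-3 §28 (ii))

The tree recursion of mine-3 §28 transports every subtree as a VIRTUAL COMPONENT `(ξ_i, π̃_i)` with
`ξ_i ∈ [0, 1]` and `π̃_i ≥ max 0 (1 − 2ξ_i)`, and the (P) functional of the tree is a positive multiple
of the bracket

`Br = ∏_i (3 − ξ_i) − 2^{k+1}·Z_A + 2K_A·∏_i (π̃_i + 2ξ_i) − K_A Z_A·∏_i (π̃_i + 3ξ_i − 1)`.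

`Br` is nondecreasing in every `π̃_i` (each factor `π̃_j + 2ξ_j ≥ π̃_j + 3ξ_j − 1 ≥ 0`, `Z_A ≤ 2`), and
at `π̃_i = max 0 (1 − 2ξ_i)` it is the closed form of the star with pendant cells `(ξ_i, K_min ξ_i)`,
`≥ 0` by THEOREM S: hence `bracket_nonneg`.
-/

namespace PercRepro

namespace MultiGraph

open Finset

variable {ι : Type*} [Fintype ι] [DecidableEq ι]

/-- The star bracket with virtual components `(ξ, π̃)` and probe cells `(Z, K)`. -/
noncomputable def bracket (ξ π : ι → ℝ) (Z K : ℝ) : ℝ :=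
  (∏ i, (3 - ξ i)) - 2 ^ (Fintype.card ι + 1) * Z + 2 * K * ∏ i, (π i + 2 * ξ i) -
    K * Z * ∏ i, (π i + 3 * ξ i - 1)

omit [Fintype ι] [DecidableEq ι] in
/-- Telescoping: a product is nondecreasing in the product order on nonnegative factors, and the
increment dominates the increment of a smaller product with the same differences. -/
theorem prod_sub_prod_ge (s : Finset ι) (b b₀ d d₀ : ι → ℝ) (hb₀ : ∀ i, 0 ≤ b₀ i)
    (hd₀ : ∀ i, 0 ≤ d₀ i) (hbd : ∀ i, d i ≤ b i) (hbd₀ : ∀ i, d₀ i ≤ b₀ i)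
    (hb : ∀ i, b₀ i ≤ b i) (hdiff : ∀ i, b i - b₀ i = d i - d₀ i) :
    ∏ i ∈ s, d i - ∏ i ∈ s, d₀ i ≤ ∏ i ∈ s, b i - ∏ i ∈ s, b₀ i := by
  classical
  induction s using Finset.induction_on with
  | empty => simp
  | insert j s hj ih =>
    rw [Finset.prod_insert hj, Finset.prod_insert hj, Finset.prod_insert hj, Finset.prod_insert hj]
    have hd : ∀ i, 0 ≤ d i := fun i => (hd₀ i).trans (by linarith [hdiff i, hb i])
    have hpb₀ : 0 ≤ ∏ i ∈ s, b₀ i := Finset.prod_nonneg fun i _ => hb₀ i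
    have hpd₀ : 0 ≤ ∏ i ∈ s, d₀ i := Finset.prod_nonneg fun i _ => hd₀ i
    have hpd : 0 ≤ ∏ i ∈ s, d i := Finset.prod_nonneg fun i _ => hd i
    have hpdb : ∏ i ∈ s, d i ≤ ∏ i ∈ s, b i := Finset.prod_le_prod (fun i _ => hd i) fun i _ => hbd i
    have hpdb₀ : ∏ i ∈ s, d₀ i ≤ ∏ i ∈ s, b₀ i :=
      Finset.prod_le_prod (fun i _ => hd₀ i) fun i _ => hbd₀ i
    have hpdd₀ : ∏ i ∈ s, d₀ i ≤ ∏ i ∈ s, d i :=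
      Finset.prod_le_prod (fun i _ => hd₀ i) fun i _ => by linarith [hdiff i, hb i]
    have hδ : 0 ≤ b j - b₀ j := sub_nonneg.2 (hb j)
    have t1 : (b j - b₀ j) * ∏ i ∈ s, d i ≤ (b j - b₀ j) * ∏ i ∈ s, b i :=
      mul_le_mul_of_nonneg_left hpdb hδ
    have t2 : d₀ j * (∏ i ∈ s, d i - ∏ i ∈ s, d₀ i) ≤ b₀ j * (∏ i ∈ s, d i - ∏ i ∈ s, d₀ i) :=
      mul_le_mul_of_nonneg_right (hbd₀ j) (sub_nonneg.2 hpdd₀)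
    have t3 : b₀ j * (∏ i ∈ s, d i - ∏ i ∈ s, d₀ i) ≤ b₀ j * (∏ i ∈ s, b i - ∏ i ∈ s, b₀ i) :=
      mul_le_mul_of_nonneg_left ih (hb₀ j)
    have e1 : b j * ∏ i ∈ s, b i - b₀ j * ∏ i ∈ s, b₀ i =
        (b j - b₀ j) * ∏ i ∈ s, b i + b₀ j * (∏ i ∈ s, b i - ∏ i ∈ s, b₀ i) := by ring
    have e2 : d j * ∏ i ∈ s, d i - d₀ j * ∏ i ∈ s, d₀ i =
        (b j - b₀ j) * ∏ i ∈ s, d i + d₀ j * (∏ i ∈ s, d i - ∏ i ∈ s, d₀ i) := by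
      rw [hdiff j]; ring
    rw [e1, e2]
    linarith

omit [DecidableEq ι] in
/-- The bracket is nondecreasing in the virtual slacks `π̃` (product order) when every component
satisfies `π̃_i ≥ max 0 (1 − 2ξ_i)`, `ξ_i ∈ [0, 1]`, and the probe is a band state. -/
theorem bracket_mono_pi {ξ π π₀ : ι → ℝ} (hξ : ∀ i, 0 ≤ ξ i ∧ ξ i ≤ 1)
    (hπ₀ : ∀ i, max 0 (1 - 2 * ξ i) ≤ π₀ i) (hππ : ∀ i, π₀ i ≤ π i) {Z K : ℝ}
    (hZ : 0 ≤ Z ∧ Z ≤ 1) (hK : 0 ≤ K) :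
    bracket ξ π₀ Z K ≤ bracket ξ π Z K := by
  unfold bracket
  have key := prod_sub_prod_ge univ (fun i => π i + 2 * ξ i) (fun i => π₀ i + 2 * ξ i)
    (fun i => π i + 3 * ξ i - 1) (fun i => π₀ i + 3 * ξ i - 1)
    (fun i => by linarith [hπ₀ i, le_max_left 0 (1 - 2 * ξ i), (hξ i).1])
    (fun i => by linarith [hπ₀ i, le_max_right 0 (1 - 2 * ξ i), (hξ i).1])
    (fun i => by linarith [(hξ i).2]) (fun i => by linarith [(hξ i).2])
    (fun i => by linarith [hππ i]) (fun i => by ring)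
  have hpd₀ : 0 ≤ ∏ i, (π₀ i + 3 * ξ i - 1) :=
    Finset.prod_nonneg fun i _ => by linarith [hπ₀ i, le_max_right 0 (1 - 2 * ξ i), (hξ i).1]
  have hpd : ∏ i, (π₀ i + 3 * ξ i - 1) ≤ ∏ i, (π i + 3 * ξ i - 1) :=
    Finset.prod_le_prod (fun i _ => by linarith [hπ₀ i, le_max_right 0 (1 - 2 * ξ i), (hξ i).1])
      fun i _ => by linarith [hππ i]
  nlinarith [mul_le_mul_of_nonneg_left key hK, mul_le_mul_of_nonneg_left hpd (mul_nonneg hK hZ.1),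
    mul_le_mul_of_nonneg_left (sub_nonneg.2 hpd) (mul_nonneg hK (by linarith [hZ.2] : (0:ℝ) ≤ 2 - Z))]

/-- At the corner `π̃_i = max 0 (1 − 2ξ_i)` the bracket is the closed form of the star with pendant
cells `(ξ_i, K_min ξ_i)` and probe `(Z, K)`. -/
theorem bracket_corner_eq (ξ : ι → ℝ) (hξ : ∀ i, 0 ≤ ξ i ∧ ξ i ≤ 1) (Z K : ℝ) :
    bracket ξ (fun i => max 0 (1 - 2 * ξ i)) Z K =
      (star ι).pFun none (fun v => Option.elim v Z ξ) (fun v => Option.elim v K fun i => kMin (ξ i))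
        univ := by
  rw [pFun_star_eq]
  unfold bracket
  simp only [Option.elim]
  have hkey : ∀ i, (2 - ξ i) * kMin (ξ i) = max 0 (1 - 2 * ξ i) + 2 * ξ i - 1 := by
    intro i
    rcases le_or_gt (ξ i) (1 / 2) with h1 | h1
    · rw [kMin_eq_zero_of_le h1, max_eq_right (by linarith)]
      ring
    · rw [kMin_eq_of_half_le h1.le (hξ i).2, max_eq_left (by linarith),
        mul_div_cancel₀ _ (by linarith [(hξ i).2] : (2 : ℝ) - ξ i ≠ 0)]
      ring
  have h1 : ∏ i, (1 + (2 - ξ i) * kMin (ξ i)) = ∏ i, (max 0 (1 - 2 * ξ i) + 2 * ξ i) :=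
    Finset.prod_congr rfl fun i _ => by rw [hkey i]; ring
  have h2 : ∏ i, ((2 - ξ i) * kMin (ξ i) + ξ i) = ∏ i, (max 0 (1 - 2 * ξ i) + 3 * ξ i - 1) :=
    Finset.prod_congr rfl fun i _ => by rw [hkey i]; ring
  rw [h1, h2]

/-- **The bracket is nonnegative** for virtual components `ξ_i ∈ [0, 1]`, `π̃_i ≥ max 0 (1 − 2ξ_i)`
and a band probe `(Z, K)` (mine-3 §28 (ii), via THEOREM S). -/
theorem bracket_nonneg {ξ π : ι → ℝ} (hξ : ∀ i, 0 ≤ ξ i ∧ ξ i ≤ 1)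
    (hπ : ∀ i, max 0 (1 - 2 * ξ i) ≤ π i) {Z K : ℝ} (hZ : 0 ≤ Z ∧ Z ≤ 1) (hK : kMin Z ≤ K) :
    0 ≤ bracket ξ π Z K := by
  have hK0 : 0 ≤ K := (kMin_nonneg Z).trans hK
  refine le_trans ?_ (bracket_mono_pi hξ (fun i => le_rfl) hπ hZ hK0)
  rw [bracket_corner_eq ξ hξ]
  refine pFun_star_nonneg (fun v => ?_) (fun v => ?_)
  · cases v with
    | none => exact hZ
    | some i => exact hξ i
  · cases v with
    | none => exact hK
    | some i => exact le_rfl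

end MultiGraph

end PercRepro
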